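import Mathlib

/-!
# LangWeilTransfer, support item `TameResolution` (stmt-ValiantsHypothesis-6378) — algebraic
# helpers for the parametrisation step

Route `LangWeilTransfer` of `ValiantsHypothesis` (conditional route; honest framing: bookkeeping,
nothing here bears on VP ≠ VNP). Step (P) of the architecture note of val-lit-p6 g9 takes the
irreducible factor of the relative eliminant through the generic point and differentiates the
eliminant identity in the coefficients `Λ` of the generic linear form. This file provides the
algebra for that:

* `irreducible_map_int_rat` — **Gauss**: an irreducible non-constant `Q ∈ ℤ[X_σ]` stays
  irreducible in `ℚ[X_σ]` (`ℚ[X_σ]` is the localisation of `ℤ[X_σ]` at the non-zero integers, and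
  the prime ideal `(Q)` does not meet them);
* `exists_irreducible_dvd_map_eq_zero` — in a unique factorisation domain, a non-unit element
  killed by a homomorphism to a domain has an irreducible factor killed by it;
* `pderiv_aeval_eq_sum` — the chain rule `∂_i (q ∘ f) = Σ_v (∂_v q ∘ f) · ∂_i f_v` for polynomial
  substitutions.
-/

noncomputable section

open MvPolynomial

-- the summit and the problem share the name `ValiantsHypothesis` (D-0017 single-conjunct layout)
set_option linter.dupNamespace false

namespace Summit.ValiantsHypothesis.ValiantsHypothesis.Theorems.LangWeilTransfer

/-! ### Gauss: irreducibility over `ℤ` gives irreducibility over `ℚ` -/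

section Gauss

variable {σ : Type*}

/-- An irreducible non-constant integer polynomial does not divide a non-zero integer. -/
theorem not_dvd_C_of_irreducible {Q : MvPolynomial σ ℤ} (hQ : Irreducible Q) (hdeg : Q.totalDegree ≠ 0)
    {z : ℤ} (hz : z ≠ 0) : ¬ Q ∣ C z := by
  rintro ⟨R, hR⟩
  have hR0 : R ≠ 0 := by
    rintro rfl; rw [mul_zero] at hR; exact hz (C_eq_zero.1 hR)
  have h := congrArg totalDegree hR
  rw [totalDegree_C, totalDegree_mul_of_isDomain hQ.ne_zero hR0] at h
  omega

/-- **Gauss's lemma for `ℤ[X_σ] ⊆ ℚ[X_σ]`.** An irreducible non-constant `Q ∈ ℤ[X_σ]` is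
irreducible in `ℚ[X_σ]`: `ℚ[X_σ]` is the localisation of `ℤ[X_σ]` at the image of `ℤ ∖ 0`, the
prime ideal `(Q)` misses that submonoid, so `(Q) ℚ[X_σ]` is prime. -/
theorem irreducible_map_int_rat {Q : MvPolynomial σ ℤ} (hQ : Irreducible Q) (hdeg : Q.totalDegree ≠ 0) :
    Irreducible (MvPolynomial.map (Int.castRingHom ℚ) Q) := by
  classical
  -- `ℚ[X_σ]` as an algebra over `ℤ[X_σ]` through `map (Int.castRingHom ℚ)` (Mathlib's
  -- `MvPolynomial.algebraMvPolynomial`, taken here as a term, not as an instance attribute)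
  letI : Algebra (MvPolynomial σ ℤ) (MvPolynomial σ ℚ) := MvPolynomial.algebraMvPolynomial
  have halg : algebraMap (MvPolynomial σ ℤ) (MvPolynomial σ ℚ) = MvPolynomial.map (Int.castRingHom ℚ) := by
    rw [MvPolynomial.algebraMap_def]
    rfl
  set M : Submonoid (MvPolynomial σ ℤ) := (nonZeroDivisors ℤ).map (C : ℤ →+* MvPolynomial σ ℤ) with hM
  haveI : IsLocalization M (MvPolynomial σ ℚ) := by
    rw [hM]; exact MvPolynomial.isLocalization (nonZeroDivisors ℤ) ℚ
  have hprime : (Ideal.span {Q}).IsPrime := (Ideal.span_singleton_prime hQ.ne_zero).2 hQ.prime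
  have hdisj : Disjoint (M : Set (MvPolynomial σ ℤ)) ↑(Ideal.span {Q}) := by
    rw [Set.disjoint_left]
    rintro _ ⟨z, hz, rfl⟩ hmem
    rw [SetLike.mem_coe, Ideal.mem_span_singleton] at hmem
    exact not_dvd_C_of_irreducible hQ hdeg (nonZeroDivisors.ne_zero hz) hmem
  have hP : (Ideal.map (algebraMap (MvPolynomial σ ℤ) (MvPolynomial σ ℚ)) (Ideal.span {Q})).IsPrime :=
    IsLocalization.isPrime_of_isPrime_disjoint M (MvPolynomial σ ℚ) _ hprime hdisj
  rw [Ideal.map_span, Set.image_singleton, halg] at hP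
  have hne : MvPolynomial.map (Int.castRingHom ℚ) Q ≠ 0 := by
    intro h0
    exact hQ.ne_zero (MvPolynomial.map_injective _ (RingHom.injective_int (Int.castRingHom ℚ)) (by
      rw [h0, map_zero]))
  exact ((Ideal.span_singleton_prime hne).1 hP).irreducible

end Gauss

/-! ### An irreducible factor through a zero -/

section Factor

variable {R K : Type*} [CommRing R] [IsDomain R] [UniqueFactorizationMonoid R] [CommRing K] [IsDomain K]

/-- In a unique factorisation domain, a non-zero `q` with `ψ q = 0` for a homomorphism `ψ` to a
domain has an irreducible factor `Q ∣ q` with `ψ Q = 0`. -/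
theorem exists_irreducible_dvd_map_eq_zero (ψ : R →+* K) {q : R} (hq : q ≠ 0) (hψ : ψ q = 0) : ∃ Q : R, Irreducible Q ∧ Q ∣ q ∧ ψ Q = 0 := by
  classical
  obtain ⟨f, hf, u, hfu⟩ := UniqueFactorizationMonoid.exists_prime_factors q hq
  -- `ψ (∏ f) · ψ u = 0`, `ψ u` a unit
  have hprod : ψ f.prod = 0 := by
    have h := congrArg ψ hfu
    rw [map_mul, hψ] at h
    have hunit : IsUnit (ψ u) := (u.isUnit).map ψ
    exact (hunit.mul_left_eq_zero).1 h
  rw [map_multiset_prod, Multiset.prod_eq_zero_iff, Multiset.mem_map] at hprod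
  obtain ⟨Q, hQf, hQ0⟩ := hprod
  refine ⟨Q, (hf Q hQf).irreducible, ?_, hQ0⟩
  rw [← hfu]
  exact (Multiset.dvd_prod hQf).mul_right _

end Factor

/-! ### The chain rule for partial derivatives under substitution -/

section ChainRule

variable {R : Type*} [CommRing R] {σ τ : Type*} [Fintype σ] [DecidableEq σ]

/-- **Chain rule.** For a substitution `f : σ → R[X_τ]` and `q ∈ R[X_σ]`:
`∂_i (q(f)) = Σ_v (∂_v q)(f) · ∂_i f_v`. -/
theorem pderiv_aeval_eq_sum (f : σ → MvPolynomial τ R) (q : MvPolynomial σ R) (i : τ) :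
    pderiv i (aeval f q) = ∑ v, aeval f (pderiv v q) * pderiv i (f v) := by
  classical
  induction q using MvPolynomial.induction_on with
  | C c => simp
  | add p q hp hq =>
    rw [map_add, map_add, hp, hq, ← Finset.sum_add_distrib]
    refine Finset.sum_congr rfl fun v _ => ?_
    rw [map_add, map_add, add_mul]
  | mul_X p v hp =>
    rw [map_mul, aeval_X, Derivation.leibniz, smul_eq_mul, smul_eq_mul, hp]
    have hRHS : ∀ w, aeval f (pderiv w (p * X v)) * pderiv i (f w) =
        (aeval f (pderiv w p) * pderiv i (f w)) * f v +
          (if w = v then aeval f p * pderiv i (f v) else 0) := by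
      intro w
      rw [Derivation.leibniz, smul_eq_mul, smul_eq_mul, pderiv_X, map_add, map_mul, map_mul, aeval_X]
      split_ifs with h
      · subst h
        rw [Pi.single_eq_same, map_one, mul_one]
        ring
      · rw [Pi.single_eq_of_ne (Ne.symm h), map_zero, mul_zero, zero_add, add_zero]
        ring
    simp_rw [hRHS]
    rw [Finset.sum_add_distrib, Finset.sum_ite_eq' Finset.univ v, if_pos (Finset.mem_univ v),
      ← Finset.sum_mul]
    ring

end ChainRule

end Summit.ValiantsHypothesis.ValiantsHypothesis.Theorems.LangWeilTransfer
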